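import Literature.AnabelianGeometry.EtaleTheta.ThetaRigidityToyTwisted
import Literature.AnabelianGeometry.EtaleTheta.ThetaRigidityLevels
import HarnessLib

/-!
# [EtTh] Cor. 2.18 (ii) and Prop. 2.14 (ii) over the interface `RigidData` are SCHEMAS — kernel
# witnesses at the level-`2` twisted toy

`Literature/AnabelianGeometry/EtaleTheta/ThetaRigidity.lean` (cell `abc-iut`) types [EtTh] Cor. 2.18 (ii)
("the model mono-theta environments attached to two members of the theta-class collection are
isomorphic via an isomorphism inducing the IDENTITY on `Π^tp_Y`", PRIMS p.60) and Prop. 2.14 (ii)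
("for a `K^×,(l·ℤ)`-conjugate `t` of the theta section `s`, the difference `t − s` extends to a
cocycle of `Π^tp_Y`, whose shift carries `s` to `t` and normalises `D_Y`", p.49) as the named facts
`RigidData.Cor218_ii`, `RigidData.Prop214_ii` (FROZEN FACT-LIST rows F-0621, F-0632).  Both HOLD at
every abelian toy of the interface (`ThetaRigidityToy`, `ThetaRigidityToyLevelThree`): there
`Gal(Y/X)`-conjugation acts trivially on theta sections.  At the twisted toy `RigidData.ToyTw.toy`
(`ThetaRigidityToyTwisted.lean`: `Π^tp_X = ((𝔽₂⁴ ⋊ C₂) × C₂) ⋊ ℤ`, two theta cocycles `η₁`, `η₂ = η₁ ∘ Ad(x⁻¹)`)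
they FAIL, for one reason (`RigidData.ToyTw.no_hom_restricts`): the quotient `η₁/η₂` on `Π^tp_Ÿ` is not
invariant under `Π^tp_Y`-conjugation, hence is the restriction of no homomorphism `Π^tp_Y → μ_2` —
but an identity-inducing isomorphism of the two model environments, resp. the shift `α_δ` of
Prop. 2.14 (ii), would restrict on `Π^tp_Ÿ` to exactly such a homomorphism.

* `not_forall_cor218_ii` (F-0621), `not_forall_prop214_ii` (F-0632), and the `ThetaEnvData`-level twin
  `not_forall_thetaEnvData_cor218_ii` (F-0635, via `RigidData.cor218_ii_iff`);
* the schemas are SATISFIABLE: both rows HOLD at the level-`1` toy `RigidData.Toy.toy l`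
  (`RigidData.Toy.cor218_ii`, `RigidData.Toy.prop214_ii`), so the FACT-LIST label is
  «universal-closure REFUTED; instance form PROVED».

What this MEANS: the lawless interface `RigidData` does not carry the cohomological content of [EtTh]
Prop. 2.14 (ii) (that differences of conjugate theta classes come from `Π^tp_Y`); the two rows are
consumable AT A NAMED INSTANCE only (lane C2: `Discharge/Sec2Prop214iiOfSetting`,
`Discharge/Sec2KLConjugacyProofs`, …), never as `∀ R`.  Nothing here is a statement about [EtTh]
(refereed).  Written by the cell `abc-iut` (seat abc-iut-w5-d175; F-TRANCHES 146/149 of D-0078 (S1)).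
No side taken on [IUTchIII] Cor. 3.12; typed ≠ proved.  Proof-only file.

Reference: [MochizukiEtTh2009] S. Mochizuki, *The étale theta function …*, Publ. RIMS 45 (2009):
Prop. 2.14 (ii) p.49, Cor. 2.18 (ii) p.60 (PRIMS text pages).
-/

namespace Literature.AnabelianGeometry.EtaleTheta

namespace RigidData

namespace ToyTw

open RigidData.Toy (M2 g g_ne_one)

/-! ## §1. Small lemmas on `μ_2` and on the envelope of the twisted toy -/

/-- In `ℤ/2`: from `a⁻¹ · d = b⁻¹` conclude `d = a · b`. [cite: MochizukiEtTh2009, Def 2.13 p.47] -/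
theorem M2_solve {a b d : M2} (h : a⁻¹ * d = b⁻¹) : d = a * b := by
  revert a b d; decide

/-- The cyclotome `μ_2` is central in the envelope `Π^tp_Y[μ_2]` of the twisted toy (trivial action).
[cite: MochizukiEtTh2009, Def 2.10 p.44] -/
theorem inMu_mul_comm (c : M2) (z : toy.env) :
    CycEnvelope.inMu toy.augY toy.chi c * z = z * CycEnvelope.inMu toy.augY toy.chi c := by
  refine SemidirectProduct.ext ?_ ?_
  · change c * z.left = z.left * c
    exact mul_comm _ _
  · change (1 : toy.PiY) * z.right = z.right * 1
    rw [one_mul, mul_one]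

/-- Hence `μ_2`-conjugation is trivial on the envelope. [cite: MochizukiEtTh2009, Def 2.10 p.44] -/
theorem conj_inMu_eq_one (c : M2) : MulAut.conj (CycEnvelope.inMu toy.augY toy.chi c) = 1 := by
  refine MulEquiv.ext fun z => ?_
  rw [MulAut.conj_apply, inMu_mul_comm, mul_inv_cancel_right]
  rfl

/-- `μ_2`-conjugacy classes of subgroups of the envelope are singletons.
[cite: MochizukiEtTh2009, Def 2.10 p.44] -/
theorem muConjClass_eq_singleton (H : Subgroup toy.env) :
    CycEnvelope.muConjClass toy.augY toy.chi H = {H} := by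
  have hid : ∀ a : toy.mu,
      H.map (MulAut.conj (CycEnvelope.inMu toy.augY toy.chi a)).toMonoidHom = H := by
    intro a
    rw [conj_inMu_eq_one]
    exact Subgroup.map_id H
  ext K
  simp only [CycEnvelope.muConjClass, Set.mem_setOf_eq, Set.mem_singleton_iff, hid, exists_const]

/-- The theta section splits as `s^Θ_η(g) = (η g)⁻¹ · s^alg(g)` in the envelope.
[cite: MochizukiEtTh2009, Def 2.13(i) p.47] -/
theorem sTheta_eq_inMu_mul_algSection {η : toy.PiYdd → toy.mu} (hη : η ∈ toy.thetaCocycles)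
    (q : toy.PiYdd) :
    toy.toThetaEnvData.sTheta hη q =
      CycEnvelope.inMu toy.augY toy.chi (η q)⁻¹ *
        CycEnvelope.algSection toy.augY toy.chi (toy.toThetaEnvData.inclYdd q) :=
  (SemidirectProduct.inl_left_mul_inr_right _).symm

/-! ## §2. Prop. 2.14 (ii) fails at the twisted toy -/

/-- **F-0632 `Prop214_ii` is a schema**: at the twisted toy, `t := Ad(x) ∘ s^Θ_{η₁} ∘ Ad(x⁻¹) = s^Θ_{η₂}`
is a `(l·ℤ)`-conjugate of `s^Θ_{η₁}`, but no cocycle `δ` of `Π^tp_Y` has `α_δ ∘ s^Θ_{η₁} = t`: its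
restriction to `Π^tp_Ÿ` would be the non-`Π^tp_Y`-invariant function `η₁/η₂`.
[cite: MochizukiEtTh2009, Prop 2.14(ii) p.49] -/
theorem not_forall_prop214_ii : ¬ ∀ (N : ℕ+) (l : ℕ) (R : RigidData.{0} N l), R.Prop214_ii := by
  intro h
  obtain ⟨δ, hδ, -, hshift, -⟩ := h 2 1 toy eta1 eta1_mem _ isKLConjugate_eta1_eta2
  refine no_hom_restricts (fun p => δ p) (fun p q => hδ p q) (fun p hp => ?_)
  have hl := congrArg SemidirectProduct.left (hshift ⟨p, hp⟩)
  change (eta1 ⟨p, hp⟩)⁻¹ * δ ⟨p, hp.2⟩ = (eta2 ⟨p, hp⟩)⁻¹ at hl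
  exact M2_solve hl

/-! ## §3. Cor. 2.18 (ii) fails at the twisted toy -/

/-- **F-0621 `Cor218_ii` is a schema**: at the twisted toy there is NO isomorphism of the model
mono-theta environments `M_{η₁} ≃ M_{η₂}` inducing the identity on `Π^tp_Y`: such an isomorphism is
`(u, p) ↦ (u · d(p), p)` for a homomorphism `d : Π^tp_Y → μ_2`, and carrying `Im s^Θ_{η₁}` onto the
(`μ_2`-conjugacy class of) `Im s^Θ_{η₂}` forces `d|_{Π^tp_Ÿ} = η₁/η₂`, which no homomorphism achieves.
[cite: MochizukiEtTh2009, Cor 2.18(ii) p.60] -/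
theorem not_forall_cor218_ii : ¬ ∀ (N : ℕ+) (l : ℕ) (R : RigidData.{0} N l), R.Cor218_ii := by
  intro h
  obtain ⟨e, he⟩ := h 2 1 toy eta1 eta2 eta1_mem eta2_mem
  obtain ⟨⟨E, _, _⟩, _, hsT⟩ := e
  have heE : ∀ z, CycEnvelope.proj toy.augY toy.chi (E z) = CycEnvelope.proj toy.augY toy.chi z := he
  -- the candidate homomorphism `d(p) := (E (s^alg p)).left`
  refine no_hom_restricts (fun p => (E (CycEnvelope.algSection toy.augY toy.chi p)).left)
    (fun p q => ?_) (fun p hp => ?_)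
  · change (E (CycEnvelope.algSection toy.augY toy.chi (p * q))).left = _
    rw [map_mul, map_mul, SemidirectProduct.mul_left]
    rfl
  · -- `E` fixes the cyclotome pointwise
    have hmu : ∀ a : M2, (E (CycEnvelope.inMu toy.augY toy.chi a)).left = a := by
      intro a
      by_cases ha : a = 1
      · subst ha; rw [map_one, map_one]; rfl
      · rw [M2_eq_g_of_ne_one ha]
        refine M2_eq_g_of_ne_one fun hb => g_ne_one ?_
        have hz : E (CycEnvelope.inMu toy.augY toy.chi g) = 1 := by
          refine SemidirectProduct.ext hb ?_
          change CycEnvelope.proj toy.augY toy.chi (E (CycEnvelope.inMu toy.augY toy.chi g)) =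
            CycEnvelope.proj toy.augY toy.chi (1 : toy.env)
          rw [heE, map_one]
          exact SemidirectProduct.rightHom_inl _
        rw [← map_one E] at hz
        simpa using congrArg SemidirectProduct.left (E.injective hz)
    -- `Im s^Θ_{η₁}` is carried onto `Im s^Θ_{η₂}`
    have hS := hsT
    change (fun H => H.map E.toMonoidHom) ''
        CycEnvelope.muConjClass _ _ (toy.toThetaEnvData.sTheta eta1_mem).range =
      CycEnvelope.muConjClass _ _ (toy.toThetaEnvData.sTheta eta2_mem).range at hS
    rw [muConjClass_eq_singleton, muConjClass_eq_singleton, Set.image_singleton,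
      Set.singleton_eq_singleton_iff] at hS
    have hx : E (toy.toThetaEnvData.sTheta eta1_mem ⟨p, hp⟩) ∈
        (toy.toThetaEnvData.sTheta eta1_mem).range.map E.toMonoidHom :=
      Subgroup.mem_map_of_mem _ ⟨_, rfl⟩
    rw [hS] at hx
    obtain ⟨q, hq⟩ := hx
    -- `q = ⟨p, hp⟩` since `E` induces the identity on `Π^tp_Y`
    have hqp : q = ⟨p, hp⟩ := by
      have h1 := congrArg (CycEnvelope.proj toy.augY toy.chi) hq
      rw [heE] at h1
      have h2 : ((CycEnvelope.proj toy.augY toy.chi (toy.toThetaEnvData.sTheta eta2_mem q) : toy.PiY) : P) =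
          ((CycEnvelope.proj toy.augY toy.chi (toy.toThetaEnvData.sTheta eta1_mem ⟨p, hp⟩) : toy.PiY) : P) :=
        congrArg Subtype.val h1
      exact Subtype.ext h2
    subst hqp
    -- compare left components
    have hl := congrArg SemidirectProduct.left hq
    rw [sTheta_eq_inMu_mul_algSection eta1_mem, map_mul, SemidirectProduct.mul_left, hmu] at hl
    change (eta2 ⟨p, hp⟩)⁻¹ = (eta1 ⟨p, hp⟩)⁻¹ *
      (E (CycEnvelope.algSection toy.augY toy.chi ⟨p, hp.2⟩)).left at hl
    exact M2_solve hl.symm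


/-- **F-0635 (`ThetaEnvData.Cor218_ii`, the verbatim restatement over a bare `ThetaEnvData`) is a
schema**, by transport along `RigidData.cor218_ii_iff`. [cite: MochizukiEtTh2009, Cor 2.18(ii) p.60] -/
theorem not_forall_thetaEnvData_cor218_ii : ¬ ∀ (N : ℕ+) (T : ThetaEnvData.{0} N), T.Cor218_ii :=
  fun h => not_forall_cor218_ii fun N _ R => R.cor218_ii_iff.mpr (h N R.toThetaEnvData)

end ToyTw

/-! ## §4. The two schemas are satisfiable: they HOLD at the level-`1` toy -/

namespace Toy

/-- **Cor. 2.18 (ii) HOLDS at the level-`1` toy** (one theta cocycle; the identity isomorphism).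
[cite: MochizukiEtTh2009, Cor 2.18(ii) p.60] -/
theorem cor218_ii (l : ℕ) : (toy l).Cor218_ii := by
  intro η η' hη hη'
  have h1 : η = 1 := hη
  have h2 : η' = 1 := hη'
  subst h1 h2
  exact ⟨MonoThetaEnv.Iso.refl _, fun _ => rfl⟩

/-- At the level-`1` toy every `K^×,(l·ℤ)`-conjugate of a theta section IS that theta section
(shifts and `Gal(Y/X)`-conjugations act trivially). [cite: MochizukiEtTh2009, Prop 2.14(ii) p.49] -/
theorem eq_of_isKLConjugate (l : ℕ) {η : (toy l).PiYdd → (toy l).mu} (hη : η ∈ (toy l).thetaCocycles)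
    {t : (toy l).PiYdd → (toy l).env} (ht : (toy l).IsKLConjugate ((toy l).toThetaEnvData.sTheta hη) t) :
    t = (toy l).toThetaEnvData.sTheta hη := by
  induction ht with
  | base => rfl
  | kummer t δ hδ hc _ ih =>
    funext q
    rw [ih, shift_eq_one _ _ hδ]
    rfl
  | gal t x _ ih =>
    funext q
    rw [ih, conjX_eq_one]
    change (toy l).toThetaEnvData.sTheta hη _ = _
    congr 1
    exact Subtype.ext (inv_mul_cancel_comm x (q : P))

/-- **Prop. 2.14 (ii) HOLDS at the level-`1` toy**: the conjugate `t` is the theta section itself, and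
the trivial cocycle does the job (`D_Y = 1`). [cite: MochizukiEtTh2009, Prop 2.14(ii) p.49] -/
theorem prop214_ii (l : ℕ) : (toy l).Prop214_ii := by
  intro η hη t ht
  have ht' := eq_of_isKLConjugate l hη ht
  have hδ : CycEnvelope.IsEnvCocycle (toy l).augY (toy l).chi (fun _ => (1 : (toy l).mu)) :=
    fun _ _ => Subsingleton.elim _ _
  have h1 : CycEnvelope.shift hδ = 1 := shift_eq_one _ _ hδ
  refine ⟨fun _ => 1, hδ, ?_, fun q => ?_, ?_⟩
  · rw [h1]; exact Subgroup.one_mem _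
  · rw [ht', h1]; rfl
  · change (toy l).DY.map _ = (toy l).DY
    rw [DY_eq_bot, Subgroup.map_bot]

end Toy

end RigidData

end Literature.AnabelianGeometry.EtaleTheta
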